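import Literature.AlgebraicGeometry.HodgeTheory.ComplexTorusIntegralHodgeClassesKunnethComponents
import Literature.AlgebraicGeometry.HodgeTheory.ComplexTorusIntegralHodgeClassesLefschetzTraceFormula
import HarnessLib

/-!
# The extreme Künneth projectors `π_0 = [0 × X]`, `π_{2g} = [X × 0]` (Cor. 6.3.14) and the graded traces `Tr(α^* | Hᵈ(X)) = ± deg((π_{2g−d} ∘ α) · [Δ_X])`

Sequel of g29-#5 … #8 (`ComplexTorusIntegralHodgeClassesKunnethProjectors`, `…Eigenvalues`, `…Naturality`, `…KunnethComponents`). Two more printed facts about the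
Künneth projectors `π_s = K_s[Δ_X] ∈ Hdgᵍ(X × X, ℤ)` of a complex torus `X` of dimension `g`, on the integral carriers:

* §1 Birkenhake–Lange **Corollary 6.3.14** "`π_{2g} = [X × (0)]`", "`π_0 = [(0) × X]`" (p0320–p0321; via Künnemann's Theorem 6.3.12 there, here from (6.18) at
  `n = 0`: `[Γ_{0_X}] = Σ_s 0ˢ π_{2g−s} = π_{2g}` and `ᵗΓ_{0_X} = Σ_s 0ˢ π_s = π_0`, g29-#6, with `Γ_0 = ι₁ = (1, 0)` and g27-#3's `ι₁_*1 = 1 ⊠ [pt]`, `ι₂_*1 = [pt] ⊠ 1`):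
  **`kunnethProjector_top`** `π_{2g} = 1_X ⊠ [pt_X] = p₂^*[pt_X]` and **`kunnethProjector_zero`** `π_0 = [pt_X] ⊠ 1_X = p₁^*[pt_X]` (Layer A: A4-46
  `SubtorusFrame.kunnethComponent_cycleForm_diagonal_top`, `kunnethComponent_cycleForm_diagonal_zero`);
* §2 Fulton **Example 16.1.15**, graded: "`∫_{X×X} α · Δ = Σ (−1)ⁱ trace(α^* : HⁱX → HⁱX)`" term by term — **`cast_integralHodgeClassesDeg_corrComp_kunnethProjector_cup_diagonalClass_eq_trace`**
  `deg((π_a ∘ α) · [Δ_X]) = (−1)ᵈ Tr(α^* | Hᵈ(X, ℂ))` for `α ∈ Hdgᵍ(X × X, ℤ)`, `a + d = 2g`: composing with `π_a` (g29-#8: `π_a ∘ α = K_a α`, the component in `Hᵈ ⊗ Hᵃ`)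
  isolates the degree-`d` trace of Fulton's `α^*` (Layer A's `corrMapT`, any enumerations) in g28-#9's Lefschetz formula — the mechanism by which the Künneth
  projectors make the individual traces `Tr(α^*|Hᵈ)` intersection numbers of integral classes (Layer A A1-33⁗ `torusIntegral_kunnethComponent_wedge_cycleForm_diagonal_eq_trace`).

## References
* [Lange2023AbelianVarietiesComplex] H. Lange, Abelian Varieties over the Complex Numbers, Springer 2023, §6.3.4 (6.18) (p0318 L10–L12), Prop. 6.3.10, Cor. 6.3.14
  (p0320 L30 – p0321 L5).
* [Fulton1998] W. Fulton, Intersection Theory, 2nd ed., Springer 1998, §16.1 Example 16.1.15 (p0302 L27–L40).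
* [VoisinHodgeI2002] C. Voisin, Hodge Theory and Complex Algebraic Geometry I, CUP 2002, §11.3.3 p. 287.
-/

noncomputable section

open CategoryTheory Function

namespace Literature.AlgebraicGeometry.HodgeTheory

open Literature.AlgebraicGeometry.Motives Literature.AlgebraicGeometry.Motives.HodgeStructure
open Literature.Geometry.Kaehler Literature.Geometry.Kaehler.ComplexTorus

/-! ### §0 Casts (forms) -/

section Forms

variable {V : Type*} [NormedAddCommGroup V] [NormedSpace ℝ V]

/-- `η ∧ (ψ ∘ cast) = (η ∧ ψ) ∘ cast`. [folklore] -/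
private theorem wedge_domDomCongr_finCongr₉ {k m m' : ℕ} (h : m = m') (η : V [⋀^Fin k]→L[ℝ] ℂ) (ψ : V [⋀^Fin m]→L[ℝ] ℂ) :
    η.wedge (ψ.domDomCongr (finCongr h)) = (η.wedge ψ).domDomCongr (finCongr (congrArg (k + ·) h)) := by
  subst h
  rfl

end Forms

section TorusForms

variable {ι : Type*} [Fintype ι] [DecidableEq ι] {E : Type*} [NormedAddCommGroup E] [NormedSpace ℂ E] (Φ : (ι → ℝ) ≃L[ℝ] E)

/-- The cycle form of the diagonal re-indexed along `k = k'` is the cycle form in the other presentation (it does not depend on the enumeration, A4-62).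
[cite: Lange2023AbelianVarietiesComplex, §6.2.2 (p0304 L15–L17)] -/
private theorem cycleForm_diagonal_domDomCongr_finCongr₉ {N k k' : ℕ} (f : Fin N ≃ ι) (hf : orientationSign Φ f = 1) (hk : k = k')
    (e₁ : Fin (N + k) ≃ ι ⊕ ι) (e₂ : Fin (N + k') ≃ ι ⊕ ι) :
    ((SubtorusFrame.diagonal Φ f hf).cycleForm e₁).domDomCongr (finCongr hk) = (SubtorusFrame.diagonal Φ f hf).cycleForm e₂ := by
  subst hk
  rw [domDomCongr_finCongr_self]
  exact SubtorusFrame.cycleForm_diagonal_eq_of_enum Φ f hf f hf e₁ e₂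

/-- A1-33⁗ `torusIntegral_kunnethComponent_wedge_cycleForm_diagonal_eq_trace` read with the form `α`, the diagonal form and the integration frame all in degree `N = 2g`
(`N = d + a`): `∫ (K_a α) ∧ [Δ] = (−1)ᵈ Tr(α^* | Hᵈ)`. [cite: Fulton1998, §16.1 Example 16.1.15 (p0302 L36–L40)] -/
private theorem torusIntegral_kunnethComponent_wedge_cycleForm_diagonal_eq_trace₉ {N a d : ℕ} (h : N = d + a) (f : Fin N ≃ ι)
    (hf : orientationSign Φ f = 1) (f' e'' : Fin (N + N) ≃ ι ⊕ ι) (ε₁ : Fin (a + d) ≃ ι) (ε : Fin ((a + d) + (d + a)) ≃ ι ⊕ ι)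
    (α : (E × E) [⋀^Fin N]→L[ℝ] ℂ) :
    torusIntegral (prodPeriod Φ Φ) e'' ((kunnethComponent a α).wedge ((SubtorusFrame.diagonal Φ f hf).cycleForm f')) =
      (-1 : ℂ) ^ d * LinearMap.trace ℂ (E [⋀^Fin d]→L[ℝ] ℂ) (corrMapT Φ Φ ε₁ ε (α.domDomCongr (finCongr h))) := by
  subst h
  rw [domDomCongr_finCongr_self]
  set F' : Fin ((d + a) + (a + d)) ≃ ι ⊕ ι := (finCongr (by omega)).trans f' with hF'
  have key := torusIntegral_kunnethComponent_wedge_cycleForm_diagonal_eq_trace Φ f hf F' ε₁ ε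
    ((finCongr (by omega : (d + a) + (a + d) = (d + a) + (d + a))).trans e'') α
  rw [← cycleForm_diagonal_domDomCongr_finCongr₉ Φ f hf (Nat.add_comm d a) f' F', wedge_domDomCongr_finCongr₉, ← torusIntegral_domDomCongr_finCongr,
    domDomCongr_finCongr_trans, domDomCongr_finCongr_self] at key
  exact key

end TorusForms

namespace ComplexTorusCat

section Diagonal

variable (X : ComplexTorusCat) {g₁ g : ℕ} (hgg : g₁ + g₁ = g) (eX : Fin (2 * g₁) ≃ X.toIsog.ι) (e : Fin (2 * g) ≃ (prodObj X X).toIsog.ι)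
  (hX : 2 * g₁ + 2 * 0 = 2 * g₁) (hg₁ : g₁ + g₁ = 2 * g₁) (hc : 2 * g₁ + 2 * g₁ = 2 * g) (hg' : g + g = 2 * g)

/-! ### §1 Corollary 6.3.14: `π_{2g} = [X × (0)]`, `π_0 = [(0) × X]` -/

include hgg in
/-- **COROLLARY 6.3.14, FIRST HALF: `π_{2g} = [X × (0)] = 1_X ⊠ [pt_X]`** in `Hdgᵍ(X × X, ℤ)` — the top Künneth projector is the class of the horizontal axis `X × {0} =
Γ_{0_X}`: (6.18)ᵗ at `n = 0` (g29-#6 `graphClass_intMul_eq_sum`: `[Γ_{0_X}] = Σ_s 0ˢ π_{2g−s} = π_{2g}`), `0_X = 0`, `Γ_0 = ι₁` and g27-#3's `ι₁_*(1_X) = 1_X ⊠ [pt_X]`.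
(Lange derives it from Künnemann's explicit formula, Thm. 6.3.12; Layer A: A4-46 `SubtorusFrame.kunnethComponent_cycleForm_diagonal_top`.)
[cite: Lange2023AbelianVarietiesComplex, §6.3.4 Cor. 6.3.14 (p0320 L30 – p0321 L5) and (6.18) (p0318 L10–L12)] -/
theorem kunnethProjector_top :
    kunnethProjector X eX e hX hg₁ hc hg' (2 * g₁) = integralHodgeClassesCross X X (Nat.zero_add g₁) (unitIntegralHodgeClass X) (pointIntegralHodgeClass X eX) := by
  have h := graphClass_intMul_eq_sum X eX e hX hg₁ hc hg' 0
  rw [Finset.sum_eq_single 0 (fun s _ hs ↦ by rw [zero_pow hs, zero_smul]) (fun h0 ↦ absurd (Finset.mem_range.2 (Nat.succ_pos _)) h0), pow_zero,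
    one_zsmul, Nat.sub_zero, intMul_eq_zsmul_id, zero_smul, graphHom_zero, integralHodgeClassesPushforward_inlHom_unitIntegralHodgeClass X X hgg eX eX e hX hg₁ hc hg'] at h
  exact h.symm

include hgg in
/-- **`π_{2g} = p₂^*[pt_X]`** (the same class, `1 ⊠ δ = p₂^*δ`). [cite: Lange2023AbelianVarietiesComplex, §6.3.4 Cor. 6.3.14 (p0320 L30 – p0321 L5)] -/
theorem kunnethProjector_top_eq_pullbackHom_sndHom :
    kunnethProjector X eX e hX hg₁ hc hg' (2 * g₁) = integralHodgeClassesPullbackHom (sndHom X X) g₁ (pointIntegralHodgeClass X eX) := by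
  rw [kunnethProjector_top X hgg, integralHodgeClassesCross_unitIntegralHodgeClass_left]

include hgg in
/-- **COROLLARY 6.3.14, SECOND HALF: `π_0 = [(0) × X] = [pt_X] ⊠ 1_X`** — the bottom Künneth projector is the class of the vertical axis `{0} × X = ᵗΓ_{0_X}`: (6.18) at
`n = 0` (g29-#6 `integralHodgeClassesPushforward_swapHom_graphClass_intMul_eq_sum`: `ᵗΓ_{0_X} = Σ_s 0ˢ π_s = π_0`), `Γ_0 = ι₁`, `ι₁ ≫ τ = ι₂` and g27-#3's `ι₂_*(1_X) =
[pt_X] ⊠ 1_X`. (Layer A: A4-62 `kunnethComponent_cycleForm_diagonal_zero`, `π_0 = pr₁^* vol_X`.)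
[cite: Lange2023AbelianVarietiesComplex, §6.3.4 Cor. 6.3.14 (p0320 L30 – p0321 L5) and Prop. 6.3.10 (p0318 L48)] -/
theorem kunnethProjector_zero :
    kunnethProjector X eX e hX hg₁ hc hg' 0 = integralHodgeClassesCross X X (Nat.add_zero g₁) (pointIntegralHodgeClass X eX) (unitIntegralHodgeClass X) := by
  have h := integralHodgeClassesPushforward_swapHom_graphClass_intMul_eq_sum X eX e hX hg₁ hc hg' 0
  rw [Finset.sum_eq_single 0 (fun s _ hs ↦ by rw [zero_pow hs, zero_smul]) (fun h0 ↦ absurd (Finset.mem_range.2 (Nat.succ_pos _)) h0), pow_zero,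
    one_zsmul, intMul_eq_zsmul_id, zero_smul, graphHom_zero,
    ← integralHodgeClassesPushforward_comp 0 g₁ (inlHom X X) eX e hX hg₁ hc hg' g₁ (swapHom X X) e hc hg', inlHom_swapHom,
    integralHodgeClassesPushforward_inrHom X X hgg eX eX e hg₁ hg' (Nat.add_zero g₁) hX hc] at h
  exact h.symm

include hgg in
/-- **`π_0 = p₁^*[pt_X]`** (`γ ⊠ 1 = p₁^*γ`). [cite: Lange2023AbelianVarietiesComplex, §6.3.4 Cor. 6.3.14 (p0320 L30 – p0321 L5)] -/
theorem kunnethProjector_zero_eq_pullbackHom_fstHom :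
    kunnethProjector X eX e hX hg₁ hc hg' 0 = integralHodgeClassesPullbackHom (fstHom X X) g₁ (pointIntegralHodgeClass X eX) := by
  rw [kunnethProjector_zero X hgg, integralHodgeClassesCross_unitIntegralHodgeClass_right]

/-! ### §2 Example 16.1.15, graded: `deg((π_a ∘ α) · [Δ_X]) = (−1)ᵈ Tr(α^* | Hᵈ(X))`, `a + d = 2g` -/

variable {nT gT l₃ : ℕ} (eT : Fin nT ≃ (prodObj X (prodObj X X)).toIsog.ι) (h3 : l₃ + 2 * g = nT) (hgT : gT + gT = nT) (h3' : l₃ + 2 * g₁ = 2 * g)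

/-- **THE GRADED LEFSCHETZ TRACE THROUGH THE KÜNNETH PROJECTORS: `deg_{X×X}((π_a ∘ α) · [Δ_X]) = (−1)ᵈ Tr(α^* : Hᵈ(X, ℂ) → Hᵈ(X, ℂ))`** for `α ∈ Hdgᵍ(X × X, ℤ)` and
`a + d = 2g` — the `d`-th term of Fulton's "`∫_{X×X} α · Δ = Σ (−1)ⁱ trace(α^* : HⁱX → HⁱX)`" (g28-#9 `cast_integralHodgeClassesDeg_cup_diagonalClass_eq_sum_trace`) is
itself the intersection number of two INTEGRAL classes, the diagonal and the composite `π_a ∘ α` with the Künneth projector (`π_a ∘ α = K_a α ∈ Hᵈ ⊗ Hᵃ`, g29-#8; only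
this component of `α` acts on `Hᵈ`). `α^*` is Layer A's `corrMapT` of the form of `α` (Def. 16.1.2), in any enumerations `ε₁`, `ε`; the composite is formed on
`X × (X × X)` in any frame `eT`. [cite: Fulton1998, §16.1 Example 16.1.15 (p0302 L27–L40)] [cite: Lange2023AbelianVarietiesComplex, §6.3.4 Prop. 6.3.11 (p0319 L9–L12)] -/
theorem cast_integralHodgeClassesDeg_corrComp_kunnethProjector_cup_diagonalClass_eq_trace {a d : ℕ} (had : 2 * g₁ = d + a)
    (ε₁ : Fin (a + d) ≃ X.toIsog.ι) (ε : Fin ((a + d) + (d + a)) ≃ X.toIsog.ι ⊕ X.toIsog.ι) (α : integralHodgeClasses (prodObj X X).toIsog.Φ g₁) :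
    ((integralHodgeClassesDeg (prodObj X X) e
        (integralHodgeClassesCup (prodObj X X).toIsog.Φ hgg
          (integralHodgeClassesPushforward g g₁ (liftHom (fstHom X (prodObj X X)) (sndHom X (prodObj X X) ≫ sndHom X X)) eT e h3 hgT h3' hg'
            (integralHodgeClassesCup (prodObj X (prodObj X X)).toIsog.Φ hgg
              (integralHodgeClassesPullbackHom (liftHom (fstHom X (prodObj X X)) (sndHom X (prodObj X X) ≫ fstHom X X)) g₁ α)
              (integralHodgeClassesPullbackHom (sndHom X (prodObj X X)) g₁ (kunnethProjector X eX e hX hg₁ hc hg' a))))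
          (integralHodgeClassesPushforward 0 g₁ (diagHom X) eX e hX hg₁ hc hg' (unitIntegralHodgeClass X))) : ℤ) : ℂ) =
      (-1 : ℂ) ^ d * LinearMap.trace ℂ (X.toIsog.E [⋀^Fin d]→L[ℝ] ℂ)
        (corrMapT X.toIsog.Φ X.toIsog.Φ ε₁ ε
          ((((α : integralHodgeClasses (prodObj X X).toIsog.Φ g₁) : (X.toIsog.E × X.toIsog.E) [⋀^Fin (2 * g₁)]→L[ℝ] ℂ)).domDomCongr (finCongr had))) := by
  obtain ⟨eX', heX'⟩ := exists_orientationSign_eq_one X.toIsog.Φ eX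
  have hP := coe_integralHodgeClassesCorrComp_kunnethProjector eX e hX hg₁ hc hg' eT e hgg h3 hgT h3' hg' α a
  rw [integralHodgeClassesPushforward_eq_of_enum 0 g₁ (diagHom X) eX eX' e e hX hg₁ hc hg', cast_integralHodgeClassesDeg_eq_torusIntegral, coe_integralHodgeClassesCup,
    ComplexTorus.torusIntegral_domDomCongr_finCongr, coe_integralHodgeClassesPushforward_diagHom_unitIntegralHodgeClass X eX' e hX hg₁ hc hg' heX' ((finCongr hc).trans e), hP]
  exact torusIntegral_kunnethComponent_wedge_cycleForm_diagonal_eq_trace₉ X.toIsog.Φ had eX' heX' _ _ ε₁ ε _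

/-- **`Tr(α^* | Hᵈ(X, ℂ)) = (−1)ᵈ deg((π_{2g−d} ∘ α) · [Δ_X])`**: each graded trace of an integral correspondence is, up to sign, an intersection number of integral Hodge
classes on `X × X`. [cite: Fulton1998, §16.1 Example 16.1.15 (p0302 L27–L40)] -/
theorem trace_corrMapT_eq_neg_one_pow_mul_cast_integralHodgeClassesDeg {a d : ℕ} (had : 2 * g₁ = d + a)
    (ε₁ : Fin (a + d) ≃ X.toIsog.ι) (ε : Fin ((a + d) + (d + a)) ≃ X.toIsog.ι ⊕ X.toIsog.ι) (α : integralHodgeClasses (prodObj X X).toIsog.Φ g₁) :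
    LinearMap.trace ℂ (X.toIsog.E [⋀^Fin d]→L[ℝ] ℂ)
        (corrMapT X.toIsog.Φ X.toIsog.Φ ε₁ ε
          ((((α : integralHodgeClasses (prodObj X X).toIsog.Φ g₁) : (X.toIsog.E × X.toIsog.E) [⋀^Fin (2 * g₁)]→L[ℝ] ℂ)).domDomCongr (finCongr had))) =
      (-1 : ℂ) ^ d * ((integralHodgeClassesDeg (prodObj X X) e
        (integralHodgeClassesCup (prodObj X X).toIsog.Φ hgg
          (integralHodgeClassesPushforward g g₁ (liftHom (fstHom X (prodObj X X)) (sndHom X (prodObj X X) ≫ sndHom X X)) eT e h3 hgT h3' hg'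
            (integralHodgeClassesCup (prodObj X (prodObj X X)).toIsog.Φ hgg
              (integralHodgeClassesPullbackHom (liftHom (fstHom X (prodObj X X)) (sndHom X (prodObj X X) ≫ fstHom X X)) g₁ α)
              (integralHodgeClassesPullbackHom (sndHom X (prodObj X X)) g₁ (kunnethProjector X eX e hX hg₁ hc hg' a))))
          (integralHodgeClassesPushforward 0 g₁ (diagHom X) eX e hX hg₁ hc hg' (unitIntegralHodgeClass X))) : ℤ) : ℂ) := by
  rw [cast_integralHodgeClassesDeg_corrComp_kunnethProjector_cup_diagonalClass_eq_trace X hgg eX e hX hg₁ hc hg' eT h3 hgT h3' had ε₁ ε α, ← mul_assoc,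
    ← mul_pow, neg_mul_neg, one_mul, one_pow, one_mul]

end Diagonal

end ComplexTorusCat

end Literature.AlgebraicGeometry.HodgeTheory
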